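import Literature.NumberTheory.EllipticCurves.EmertonPollackWeston2006.WeightKMembers
import HarnessLib

/-!
# Emerton–Pollack–Weston, *Variation of Iwasawa invariants in Hida families* (Invent. Math. 163
# (2006)): Thm. 3.1.1, Thm. 1 (`μ^alg`, `f_E ↦ g`) and Thm. 5.1.3 with Thm. 4.4.5 (`g ↦ f_E`) for a
# good-ordinary higher-weight member `g` of the Hida family `H(E[p])` of an elliptic curve with
# multiplicative reduction at an ODD prime `p` — the level-generic instances of `WeightKMembers.lean`
# with their binder `5 ≤ p` relaxed to the PRINTED standing hypothesis "`p` odd" (named facts, D-0014)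

HONEST FRAMING (prover seat bsd-line-er5-p2, width seat of the line on crux stmt-BirchSwinnertonDyer-19064
`X11aLowerHalf`; cell home `run/shared/lean/pub/bsd-stepL/line-er5-p2/`): this file vendors NOTHING new in
content. It re-types the three level-generic instances `thm311_cotorsion_weightK_member_ofLevel`,
`thm1_muAlg_of_weightK_member_ofLevel`, `thm513_transfer_from_weightK_member_of_bdd_ofLevel` of
`WeightKMembers.lean` (cell `b2b-bsdres`, registry A84 ff.; audited R33.4 / lit g14 X11A-AUDIT) with ONE
binder changed — `5 ≤ p →` becomes `p ≠ 2 →` — and is otherwise BYTE-IDENTICAL to them (same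
dictionary, same bridges, same conclusions; `def … : Prop`, nothing asserted, no `_holds`). Each
`5 ≤ p` instance FOLLOWS from its odd twin (`5 ≤ p → p ≠ 2`; the one-line adapters `….of_odd` are proved in
the consumer file named below — this file is statements only; deprecate-and-add, no consumer is touched). Why: the source fixes "an odd prime `p`" and nothing more (p. 5), and the
`p = 3` instances are consumed by the `p = 3` part of crux `X11aLowerHalf`
(`Summits/BirchSwinnertonDyer/BirchSwinnertonDyer/Theorems/PrintX11aLowerHalfOddPrimeChain.lean`), where
the cell's chain (`X11a.forall_bsdp_of_namedFacts_ofLevel_heightFree`, `NonSurjChain.*`) was typed at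
`5 ≤ p` only because its OTHER GL₂ input, X. Wan's Forum Math. Sigma 3 (2015) Thm. 4, is printed under
"Suppose that `p ⩾ 5`" (p. 4) — that input is NOT re-typed here or anywhere (at `p = 3` it stays a
displayed hypothesis of the consumer).

## Source (arXiv:math/0404484; pages of that text), the binder that changes

* p. 5, Notation: "We fix an odd prime `p` and let `ℚ_∞` denote the cyclotomic `ℤ_p`-extension of
  `ℚ`." — the ONLY standing restriction on `p` in the paper; Thm. 1 (p. 2), Thm. 3.1.1 (p. 17),
  Thm. 4.4.5 / Def. 4.4.6 (p. 24), Thm. 5.1.3 (p. 30) carry no further one (quoted verbatim in the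
  module docstring of `WeightKMembers.lean` and in the three docstrings there).
* p. 2: "Let `ρ̄ : G_ℚ → GL₂(k)` be an absolutely irreducible modular Galois representation over a
  finite field `k` of characteristic `p`. Assume further that `ρ̄` is `p`-ordinary and `p`-distinguished
  in the sense that the restriction of `ρ̄` to a decomposition group at `p` is reducible and
  non-scalar."

## Faithfulness of the instance at an odd `p` (the bridges of `WeightKMembers.lean`, re-read at `p = 3`)

* `ρ̄ = E[p]`, `E[p]` irreducible, `p ‖ N`, `p` odd: absolutely irreducible (irreducible and odd —
  complex conjugation has the distinct eigenvalues `±1` since `p ≠ 2` — so Schur applies; tree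
  `isAbsolutelyIrreducible_of_hasIrreducibleModPGaloisRep`, hypothesis `p ≠ 2`); `p`-ordinary and
  `p`-distinguished: by Tate's parametrisation `ρ̄|_{G_{ℚ_p}} ≅ (δω ∗; 0 δ)` with `δ` unramified
  quadratic and `ω` the mod-`p` cyclotomic character, which is NON-trivial on `G_{ℚ_p}` for every
  `p ≥ 3` (`ω|_{I_p}` has order `p − 1 ≥ 2`; at `p = 2` it is trivial — the one prime the print and
  this file exclude) — reducible and non-scalar; modular; `f_E ∈ H(E[p])` as a `p`-new member
  (Ex. 5.3.1, any `p`); an `IsOrdinaryMemberOfLevel W p g ι` member has `ρ̄_{g,ι} ≅ E[p]`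
  (congruences at all `ℓ ∤ N`, Brauer–Nesbitt–Chebotarev; no restriction on `p`).
* E-side currencies (verbatim the bullets of `WeightKMembers.lean`): Greenberg's vs the classical
  Selmer group over `ℚ_∞` differ by the trivial-zero factor `T^e` of unit content (Skinner, Pacific
  J. Math. 283 (2016) §3.2 — "Throughout `p` is a fixed odd prime", §2 p. 5 of arXiv:1407.1093;
  Greenberg LNM 1716 Prop. 2.4); EPW's canonical period vs the Néron period `Ω_E` at `p ‖ N` under
  (irr): a `p`-adic unit for ODD `p` (Greenberg–Vatsal 2000 §3 Prop. (3.1)/(3.3) and Rem. 3.4; Skinner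
  2016 §3.3; the Manin constant is prime to every odd `p` with `p² ∤ N` — Mazur 1978 Cor. 4.1, tree
  fact `mazur_not_dvd_maninConstant_of_odd` and tree theorem
  `exists_unit_mul_plusPeriod_of_irreducible_of_mazur`, hypothesis `p ≠ 2`) — flag
  `EPW-canonical-period` (N1 of the audit) exactly as at `p ≥ 5`.
* `g`-side: unchanged (`μ^alg(g) = 0` ⟺ a generator of `charIdeal` has a coefficient of norm `1`;
  `λ = normLam`, Def. 4.4.6; THE bounded cyclotomic `p`-adic `L`-function `IsCycPAdicLFunctionWeightK`,
  MTT §I.14, any `p`).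
* Flag proposed for the referee (informational; the statements are typed as PRINTED, for odd `p`):
  `EPW-Thm212-Hida86@3` — EPW's Thm. 2.1.2 (control / freeness of the ordinary Hecke algebra `𝕋_N`,
  p. 7) is quoted from [hida1] = Hida, Ann. Sci. ÉNS 19 (1986) and [hida2] = Hida, Invent. Math. 85
  (1986), whose own standing hypothesis is `p ≥ 5`; EPW state their theorems for "an odd prime `p`"
  (p. 5) without comment on `p = 3`. Nothing here asserts the theorems (no `_holds`).

What this file does NOT do: it does not type Wan 2015 Thm. 4 at `p = 3` (printed `p ⩾ 5`), nor any
cyclotomic GL₂ divisibility at `p = 3`; it changes no existing declaration.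

References: [EmertonPollackWeston2006] Thm. 1, Thm. 2.1.2, Thm. 3.1.1, Thm. 4.4.5, Def. 4.4.6,
Thm. 5.1.3, Ex. 5.3.1, Notation p. 5; [Skinner2016PacificMC] §2 (p. 5: odd `p`), §3.2–3.3;
[GreenbergVatsal2000] §3; [Mazur1978] Cor. 4.1; [MazurTateTeitelbaum1986Invent] §I.11, §I.14;
[Hida1986ENS] = [hida1], [Hida1986Invent] = [hida2] (both `p ≥ 5`).
-/

noncomputable section

open scoped Classical MatrixGroups ModularForm

open NumberField IsDedekindDomain Field CongruenceSubgroup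
open Literature.NumberTheory.GaloisRepresentations
open Literature.NumberTheory.EllipticCurves.ModularForms
open Literature.NumberTheory.EllipticCurves.GreenbergVatsal2000

namespace Literature.NumberTheory.EllipticCurves.EmertonPollackWeston2006

/-- **Emerton–Pollack–Weston 2006, Thm. 3.1.1 (cotorsion; [Kato], [KKT]) — the level-generic
instance `thm311_cotorsion_weightK_member_ofLevel` at an ODD prime** (its binder `5 ≤ p` relaxed to
the printed "`p` odd", p. 5; otherwise byte-identical). "Let `f` be a `p`-ordinary and `p`-stabilized
newform with `ρ̄_f` absolutely irreducible. Then `Sel(ℚ_∞, A_f)` is co-finitely generated,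
`Λ_𝒪`-cotorsion" (arXiv:math/0404484 p. 17; §3.1: any weight `k ≥ 2`, any tame level). Instance:
`E/ℚ` globally minimal, `p ≠ 2`, `p ‖ N` (multiplicative), `E[p]` irreducible; `M` with `p ∤ M`;
`(g, ι)` an ordinary member of `H(E[p])` of level `M` (`IsOrdinaryMemberOfLevel`, so `ρ̄_{g,ι} ≅ E[p]`
is absolutely irreducible — `p` odd); for ALL ordinary `p`-adic data `𝔇` of `(g, ι)`, the cyclotomic
`ℤ_p`-extension `κ` with topological generator `γ`, and every `Λ_𝒪`-dual datum `D` of Greenberg's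
`Sel(ℚ_∞, A_g)`: `D.X` is finitely generated and torsion over `Λ_𝒪 = 𝒪⟦T⟧`. The `5 ≤ p` instance is
this one restricted to `5 ≤ p`. Named fact; nothing asserted.
-- TODO(general form): any p-ordinary p-stabilised newform with ρ̄ absolutely irreducible, twists ω^i.
[cite: EmertonPollackWeston2006, Thm. 3.1.1 and §3.1 (arXiv:math/0404484 p. 17), Notation p. 5 (odd p), Intro p. 2 (H(ρ̄))] -/
def thm311_cotorsion_weightK_member_ofLevel_odd : Prop :=
  ∀ (W : WeierstrassCurve ℚ) [W.IsElliptic] [W.IsGloballyMinimal] (p : ℕ) [Fact p.Prime],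
    p ≠ 2 → W.HasMultiplicativeReductionAtPrime p → W.HasIrreducibleModPGaloisRep p →
    ∀ {M : ℕ} [NeZero M], ¬ p ∣ M → ∀ {k : ℤ} (g : CuspForm (Gamma0 M) k)
      (ι : coeffField g →+* PadicAlgCl p), IsOrdinaryMemberOfLevel W p g ι →
    ∀ (𝔇 : OrdinaryPadicData g p ι) (κ : ZpExtension ℚ p) (γ : Field.absoluteGaloisGroup ℚ),
      κ.IsCyclotomic → κ.IsTopGenerator γ →
    ∀ (D : GreenbergSelmer.DualData (padicCoeffField (memberGenerators g ι 𝔇.υ)) κ γ 𝔇.ρ 𝔇.plus),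
      Module.Finite (PowerSeries (padicCoeffIntegers (memberGenerators g ι 𝔇.υ))) D.X ∧
        Module.IsTorsion (PowerSeries (padicCoeffIntegers (memberGenerators g ι 𝔇.υ))) D.X

/-- **Emerton–Pollack–Weston 2006, Thm. 1 with `* = alg`, instance `f₀ = f_E ↦ f = g` — the
level-generic instance `thm1_muAlg_of_weightK_member_ofLevel` at an ODD prime** (binder `5 ≤ p`
relaxed to the printed "`p` odd", p. 5; otherwise byte-identical). "Fix `* ∈ {alg, an}`. If
`μ^*(f₀) = 0` for some `f₀ ∈ H(ρ̄)`, then `μ^*(f) = 0` for all `f ∈ H(ρ̄)`" (arXiv:math/0404484 p. 2;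
`H(ρ̄)` = all `p`-ordinary `p`-stabilized newforms with mod `p` representation `ρ̄`, every tame
level; `ρ̄` absolutely irreducible, `p`-ordinary, `p`-distinguished — for `ρ̄ = E[p]` at `p ‖ N` these
hold at every odd `p`, module docstring; `μ^alg` of §3.1 p. 17). Instance and bridges exactly as in
`thm1_muAlg_of_weightK_member_ofLevel`: `E/ℚ` globally minimal, `p ≠ 2`, `p ‖ N`, `E[p]` irreducible;
HYPOTHESIS `μ^alg(f_E) = 0` ("`X(E/ℚ_∞)` is `Λ`-torsion with `μ = 0` for every cyclotomic datum and
every dual datum"); CONCLUSION `μ^alg(g) = 0` for every ordinary member `(g, ι)` of level `M`,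
`p ∤ M`: for all ordinary `p`-adic data, cyclotomic `(κ, γ)`, torsion dual data `D` and every
generator `G` of `charIdeal(D)`, some coefficient of `G` has `p`-adic norm `1`. The `5 ≤ p` instance
is this one restricted to `5 ≤ p`. Named fact; nothing asserted.
-- TODO(general form): Thm. 1 for arbitrary pairs f₀, f ∈ H(ρ̄) and twists ω^i; * = an needs
-- canonical periods (here only through Thm. 4.4.5 inside the Thm. 5.1.3 facts).
[cite: EmertonPollackWeston2006, Thm. 1 and Intro p. 2 (H(ρ̄)) (arXiv:math/0404484 p. 2), §3.1 (p. 17), Notation p. 5 (odd p)]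
[cite: Skinner2016PacificMC, §3.2 (arXiv:1407.1093 p0014 L12–L40) and §2 (p0005: odd p)] -/
def thm1_muAlg_of_weightK_member_ofLevel_odd : Prop :=
  ∀ (W : WeierstrassCurve ℚ) [W.IsElliptic] [W.IsGloballyMinimal] (p : ℕ) [Fact p.Prime],
    p ≠ 2 → W.HasMultiplicativeReductionAtPrime p → W.HasIrreducibleModPGaloisRep p →
    -- `μ^alg(f_E) = 0`
    (∀ (κ : ZpExtension ℚ p) (γ : Field.absoluteGaloisGroup ℚ), κ.IsCyclotomic →
        κ.IsTopGenerator γ → IsCyclotomicVariable p γ →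
        ∀ D : W.SelmerDualData κ γ, D.IsTorsion ∧ D.mu = 0) →
    ∀ {M : ℕ} [NeZero M], ¬ p ∣ M → ∀ {k : ℤ} (g : CuspForm (Gamma0 M) k)
      (ι : coeffField g →+* PadicAlgCl p), IsOrdinaryMemberOfLevel W p g ι →
    ∀ (𝔇 : OrdinaryPadicData g p ι) (κ : ZpExtension ℚ p) (γ : Field.absoluteGaloisGroup ℚ),
      κ.IsCyclotomic → κ.IsTopGenerator γ → IsCyclotomicVariable p γ →
    ∀ (D : GreenbergSelmer.DualData (padicCoeffField (memberGenerators g ι 𝔇.υ)) κ γ 𝔇.ρ 𝔇.plus),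
      Module.IsTorsion (PowerSeries (padicCoeffIntegers (memberGenerators g ι 𝔇.υ))) D.X →
    ∀ G : PowerSeries (padicCoeffIntegers (memberGenerators g ι 𝔇.υ)),
      D.charIdeal = Ideal.span {G} →
      ∃ n : ℕ, ‖((PowerSeries.coeff n G : padicCoeffIntegers (memberGenerators g ι 𝔇.υ)) :
        PadicAlgCl p)‖ = 1

/-- **Emerton–Pollack–Weston 2006, Thm. 5.1.3 with source `f₀ = g` and target `f = f_E` (Thm. 4.4.5
for `μ^an`), bounded (print-faithful) interpolant — the level-generic instance
`thm513_transfer_from_weightK_member_of_bdd_ofLevel` at an ODD prime** (binder `5 ≤ p` relaxed to the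
printed "`p` odd", p. 5; otherwise byte-identical). Thm. 5.1.3 (arXiv:math/0404484 p. 30): "Suppose
that `μ^alg(f₀,ω^i) = μ^an(f₀,ω^i) = 0` and `λ^alg(f₀,ω^i) = λ^an(f₀,ω^i)` for some `f₀` in the Hida
family attached to `ρ̄` and some `i`. Then `μ^alg(f,ω^i) = μ^an(f,ω^i) = 0` and
`λ^alg(f,ω^i) = λ^an(f,ω^i)` for every `f` in the Hida family attached to `ρ̄`"; Thm. 4.4.5 (p. 24):
`μ^an` vanishes for one ordinary newform of the family iff for every one. Instance, bridges,
hypotheses (`μ^alg(g) = 0`, `λ^alg(g) = λ^an(g)` for THE bounded cyclotomic `p`-adic `L`-function of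
`(g, ι, υ)`, `μ^an(f_E) = 0` Néron-normalised — at `p ‖ N`, (irr), `p` odd the Néron and canonical
normalisations differ by a `p`-adic unit: Greenberg–Vatsal 2000 §3, Skinner 2016 §3.3, Mazur 1978
Cor. 4.1, module docstring) and CONCLUSION at `f = f_E` (unit contents and `normLam gK = normLam fE`
at every Kato pair) VERBATIM as in `thm513_transfer_from_weightK_member_of_bdd_ofLevel`; flag
`EPW-canonical-period` as there. The `5 ≤ p` instance is this one restricted to
`5 ≤ p`. Named fact; nothing asserted; no `_holds`.
-- TODO(general form): Thm. 5.1.3 for arbitrary f₀, f ∈ H(ρ̄), twists ω^i; μ^an via canonical periods.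
[cite: EmertonPollackWeston2006, Thm. 5.1.3 (arXiv:math/0404484 p. 30), Thm. 4.4.5 and Def. 4.4.6 (p. 24), Thm. 1, Intro p. 2 (H(ρ̄)), Ex. 5.3.1 (p. 32), Notation p. 5 (odd p)]
[cite: Skinner2016PacificMC, §3.2 (arXiv:1407.1093 p0014) and §3.3 (p0016), §2 (p0005: odd p)]
[cite: GreenbergVatsal2000, §3 Prop. (3.1), Prop. (3.3), Remark 3.4]
[cite: Mazur1978, Cor. 4.1]
[cite: MazurTateTeitelbaum1986Invent, §I.11 and §I.14 (14.3)] -/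
def thm513_transfer_from_weightK_member_of_bdd_ofLevel_odd : Prop :=
  ∀ (W : WeierstrassCurve ℚ) [W.IsElliptic] [W.IsGloballyMinimal] (p : ℕ) [Fact p.Prime],
    p ≠ 2 → W.HasMultiplicativeReductionAtPrime p → W.HasIrreducibleModPGaloisRep p →
    ∀ {M : ℕ} [NeZero M], ¬ p ∣ M → ∀ {k : ℤ} (g : CuspForm (Gamma0 M) k)
      (ι : coeffField g →+* PadicAlgCl p), IsOrdinaryMemberOfLevel W p g ι →
    ∀ (𝔇 : OrdinaryPadicData g p ι) (κ : ZpExtension ℚ p) (γ : Field.absoluteGaloisGroup ℚ),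
      κ.IsCyclotomic → κ.IsTopGenerator γ → IsCyclotomicVariable p γ →
    ∀ (D : GreenbergSelmer.DualData (padicCoeffField (memberGenerators g ι 𝔇.υ)) κ γ 𝔇.ρ 𝔇.plus),
      Module.IsTorsion (PowerSeries (padicCoeffIntegers (memberGenerators g ι 𝔇.υ))) D.X →
    ∀ G : PowerSeries (padicCoeffIntegers (memberGenerators g ι 𝔇.υ)),
      D.charIdeal = Ideal.span {G} →
    ∀ (Dsym : PeriodSymbolDatum g) (L : PowerSeries (PadicAlgCl p)),
      IsCycPAdicLFunctionWeightK g Dsym p ι 𝔇.υ L →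
      (∃ C : ℝ, ∀ i, ‖PowerSeries.coeff i L‖ ≤ C) →
    -- hypotheses of Thm. 5.1.3 at `f₀ = g`: `μ^alg(g) = 0`, `λ^alg(g) = λ^an(g)` …
    (∃ n : ℕ, ‖((PowerSeries.coeff n G : padicCoeffIntegers (memberGenerators g ι 𝔇.υ)) :
        PadicAlgCl p)‖ = 1) →
    normLam (PowerSeries.map (padicCoeffIntegers (memberGenerators g ι 𝔇.υ)).subtype G) = normLam L →
    -- … and `μ^an(g) = 0` in the form `μ^an(f_E) = 0` (Thm. 4.4.5), Néron-normalised
    (∀ {N : ℕ} [NeZero N] (f : CuspForm (Gamma0 N) 2), IsNewformOf W f →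
        ∀ (ϖ : ℚ), (ϖ : ℝ) * W.realPeriodRat = plusPeriod f →
          (¬ W.HasSplitMultiplicativeReductionAtPrime p →
            ∀ Lp : PowerSeries ℚ_[p], IsMultPAdicLFunctionOf f p (-1) Lp →
              ∃ n : ℕ, ‖PowerSeries.coeff n (PowerSeries.C ((ϖ : ℚ) : ℚ_[p]) * Lp)‖ = 1) ∧
          (W.HasSplitMultiplicativeReductionAtPrime p →
            ∀ Lp : PowerSeries ℚ_[p], IsSplitMultPAdicLFunctionOf f p Lp →
              ∃ n : ℕ, ‖PowerSeries.coeff n (PowerSeries.C ((ϖ : ℚ) : ℚ_[p]) * Lp)‖ = 1)) →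
    -- conclusion at `f = f_E`: `μ = 0` and `λ^alg(f_E) = λ^an(f_E)`, at every Kato pair
    ∀ (κ' : ZpExtension ℚ p) (γ' : Field.absoluteGaloisGroup ℚ),
        κ'.IsCyclotomic → κ'.IsTopGenerator γ' → IsCyclotomicVariable p γ' →
      ∀ {N : ℕ} [NeZero N] (f : CuspForm (Gamma0 N) 2), IsNewformOf W f →
      ∀ (D' : W.SelmerDualData κ' γ') (ϖ : ℚ), (ϖ : ℝ) * W.realPeriodRat = plusPeriod f →
      ∀ (fE gK : IwasawaAlgebra p), D'.charIdeal = Ideal.span {fE} →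
        (¬ W.HasSplitMultiplicativeReductionAtPrime p →
          ∀ Lp : PowerSeries ℚ_[p], IsMultPAdicLFunctionOf f p (-1) Lp →
            iwasawaToPowerSeries p gK = PowerSeries.C ((ϖ : ℚ) : ℚ_[p]) * Lp →
              HasUnitContent gK ∧ HasUnitContent fE ∧ normLam gK = normLam fE) ∧
        (W.HasSplitMultiplicativeReductionAtPrime p →
          ∀ Lp : PowerSeries ℚ_[p], IsSplitMultPAdicLFunctionOf f p Lp →
            iwasawaToPowerSeries p (PowerSeries.X * gK) = PowerSeries.C ((ϖ : ℚ) : ℚ_[p]) * Lp →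
              HasUnitContent gK ∧ HasUnitContent fE ∧ normLam gK = normLam fE)

end Literature.NumberTheory.EllipticCurves.EmertonPollackWeston2006

end
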